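import Summits.AtomisticToContinuum.FouriersLaw.Theorems.BondHeatUncertaintyBoundedResponseTransientContactSpectrumB

/-!
# `SurplusSpectrum` (`TransientContactSpectrum`) — the junction-side reading of the transient floor (lens-1 g92 node A) — part 3 of 3 (sequel of `…BondHeatUncertaintyBoundedResponseTransientContactSpectrumB`)

Split for the 400-line cap by the landing lane (hand-2 g35); the module docstring of part 1 (`…BondHeatUncertaintyBoundedResponseTransientContactSpectrumA`) describes the whole node.  Same namespace; all FQNs unchanged.
0 sorry; standard axioms.
-/

noncomputable section

namespace Summit.AtomisticToContinuum.FouriersLaw.Theorems.BoundedResponse.TransientContact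

open MeasureTheory ProbabilityTheory Filter Set Topology
open Literature.MathematicalPhysics.KineticTheory.HeatConduction
open Summit.AtomisticToContinuum.FouriersLaw.Theses.BondHeatUncertainty
open Summit.AtomisticToContinuum.FouriersLaw.Theorems.SubdiffusiveBondHeat
open Summit.AtomisticToContinuum.FouriersLaw.Theorems.BoundedResponse.TransientBand
  (integral_min_mul_eq_sub integral_min_mul_ge_of_floor integrableOn_cos_mul_kernel abs_cosTransform_le dip_eq_sub_cosTransform
    measurable_cosTransform cosTransform_nonneg_of_lagIntegral_nonneg integral_fejer_mul_cosTransform fejerWeight_le integral_Ioc_fejerWeight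
    one_le_two_sub_sin_div integrable_fejerAverage highBand_spectral_ge)

/-! ### The contact kernel `C^g_N`: closed form of `g`, domination, statics, regularity, positivity -/

section ContactKernel

open Literature.MathematicalPhysics.KineticTheory Literature.Probability.Process OscillatorChain
open scoped NNReal

variable {ω₂ lam β γ T : ℝ} {N : ℕ}

/-- Closed form `g(x) = (γ/(2T²))·(p_0² − p_{N−1}²)` for `N ≥ 1`. [folklore] -/
theorem contactImbalance_eq (P : OscillatorChain) (T : ℝ) (hN : 0 < N) (x : PhaseSpace N) :
    contactImbalance P T N x = P.γ / (2 * T ^ 2) *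
      (x.2 ⟨0, hN⟩ ^ 2 - x.2 ⟨N - 1, Nat.sub_lt hN Nat.one_pos⟩ ^ 2) := by
  unfold contactImbalance
  have e1 : ∑ i : Fin N, (if i.val = 0 then x.2 i ^ 2 else 0) = x.2 ⟨0, hN⟩ ^ 2 := by
    rw [Fintype.sum_eq_single ⟨0, hN⟩ fun i hi => if_neg fun h => hi (Fin.ext h)]
    exact if_pos rfl
  have e2 : ∑ i : Fin N, (if i.val = N - 1 then x.2 i ^ 2 else 0) =
      x.2 ⟨N - 1, Nat.sub_lt hN Nat.one_pos⟩ ^ 2 := by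
    rw [Fintype.sum_eq_single ⟨N - 1, Nat.sub_lt hN Nat.one_pos⟩
      fun i hi => if_neg fun h => hi (Fin.ext h)]
    exact if_pos rfl
  rw [Finset.sum_sub_distrib, e1, e2]

/-- `g = 0` on the empty chain. [folklore] -/
theorem contactImbalance_zero (P : OscillatorChain) (T : ℝ) (x : PhaseSpace 0) :
    contactImbalance P T 0 x = 0 := by
  unfold contactImbalance
  simp

/-- `C^g_0 = 0`. [folklore] -/
theorem contactImbalanceCorr_zero (P : OscillatorChain) (T u : ℝ) :
    contactImbalanceCorr P T 0 u = 0 := by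
  unfold contactImbalanceCorr
  simp [contactImbalance_zero]

/-- `g` is continuous. [folklore] -/
theorem continuous_contactImbalance (P : OscillatorChain) (T : ℝ) (N : ℕ) :
    Continuous (contactImbalance P T N) := by
  rcases Nat.eq_zero_or_pos N with h | hN
  · subst h
    have : contactImbalance P T 0 = fun _ => 0 := funext (contactImbalance_zero P T)
    rw [this]; exact continuous_const
  · have : contactImbalance P T N = fun x => P.γ / (2 * T ^ 2) *
        (x.2 ⟨0, hN⟩ ^ 2 - x.2 ⟨N - 1, Nat.sub_lt hN Nat.one_pos⟩ ^ 2) :=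
      funext (contactImbalance_eq P T hN)
    rw [this]; fun_prop

/-- Exponential domination `|g| ≤ (γ/T²)(8T + T) e^{H/(4T)}` (`|p_i² − T| ≤ (2/ϑ + T)e^{ϑH}`,
`ϑ = 1/(4T)`). [folklore] -/
theorem abs_contactImbalance_le_exp (hω : 0 < ω₂) (hl : 0 < lam) (hβ : 0 < β) (hγ : 0 < γ)
    (hT : 0 < T) (hN : 0 < N) (y : PhaseSpace N) :
    |contactImbalance (pinnedChain ω₂ lam β γ) T N y| ≤
      γ / T ^ 2 * (2 / (1 / (4 * T)) + T) *
        Real.exp (1 / (4 * T) * (pinnedChain ω₂ lam β γ).hamiltonian N y) := by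
  have hϑ0 : 0 < 1 / (4 * T) := by positivity
  have h1 := abs_sq_momentum_sub_le_exp (γ := γ) hω hl.le hβ.le hϑ0 hT.le y ⟨0, hN⟩
  have h2 := abs_sq_momentum_sub_le_exp (γ := γ) hω hl.le hβ.le hϑ0 hT.le y
    ⟨N - 1, Nat.sub_lt hN Nat.one_pos⟩
  have hPγ : (pinnedChain ω₂ lam β γ).γ = γ := rfl
  rw [contactImbalance_eq _ T hN, hPγ, abs_mul, abs_of_pos (by positivity : 0 < γ / (2 * T ^ 2))]
  have h3 : |y.2 ⟨0, hN⟩ ^ 2 - y.2 ⟨N - 1, Nat.sub_lt hN Nat.one_pos⟩ ^ 2| ≤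
      |y.2 ⟨0, hN⟩ ^ 2 - T| + |y.2 ⟨N - 1, Nat.sub_lt hN Nat.one_pos⟩ ^ 2 - T| := by
    rw [show y.2 ⟨0, hN⟩ ^ 2 - y.2 ⟨N - 1, Nat.sub_lt hN Nat.one_pos⟩ ^ 2 =
      (y.2 ⟨0, hN⟩ ^ 2 - T) - (y.2 ⟨N - 1, Nat.sub_lt hN Nat.one_pos⟩ ^ 2 - T) by ring]
    exact abs_sub _ _
  calc γ / (2 * T ^ 2) * |y.2 ⟨0, hN⟩ ^ 2 - y.2 ⟨N - 1, Nat.sub_lt hN Nat.one_pos⟩ ^ 2|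
      ≤ γ / (2 * T ^ 2) * ((2 / (1 / (4 * T)) + T) *
          Real.exp (1 / (4 * T) * (pinnedChain ω₂ lam β γ).hamiltonian N y) +
          (2 / (1 / (4 * T)) + T) *
          Real.exp (1 / (4 * T) * (pinnedChain ω₂ lam β γ).hamiltonian N y)) :=
        mul_le_mul_of_nonneg_left (h3.trans (add_le_add h1 h2)) (by positivity)
    _ = _ := by ring

/-- Statics of `g`: `g` is mean-zero and `∫ g² dμ_T ≤ 2γ²/T²` (uniformly in `N ≥ 1`); `g²` is integrable.
[folklore] -/
theorem contactImbalance_statics (hω : 0 < ω₂) (hl : 0 < lam) (hβ : 0 < β) (hT : 0 < T)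
    (hN : 0 < N) :
    ∫ z, contactImbalance (pinnedChain ω₂ lam β γ) T N z
        ∂((pinnedChain ω₂ lam β γ).gibbsMeasure N T) = 0 ∧
      Integrable (fun z => contactImbalance (pinnedChain ω₂ lam β γ) T N z ^ 2)
        ((pinnedChain ω₂ lam β γ).gibbsMeasure N T) ∧
      ∫ z, contactImbalance (pinnedChain ω₂ lam β γ) T N z ^ 2
          ∂((pinnedChain ω₂ lam β γ).gibbsMeasure N T) ≤ 2 * γ ^ 2 / T ^ 2 := by
  set μ := (pinnedChain ω₂ lam β γ).gibbsMeasure N T with hμ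
  haveI := pinnedChain_isProbabilityMeasure_gibbsMeasure hω hl.le hβ.le γ N hT
  set i0 : Fin N := ⟨0, hN⟩
  set i1 : Fin N := ⟨N - 1, Nat.sub_lt hN Nat.one_pos⟩
  set c : ℝ := γ / (2 * T ^ 2) with hc
  have hPγ : (pinnedChain ω₂ lam β γ).γ = γ := rfl
  have hg : ∀ z, contactImbalance (pinnedChain ω₂ lam β γ) T N z =
      c * ((z.2 i0 ^ 2 - T) - (z.2 i1 ^ 2 - T)) := fun z => by
    rw [contactImbalance_eq _ T hN, hPγ, hc]; ring
  obtain ⟨ha2, ha⟩ := integral_kinDev_sq_le (γ := γ) hω hl hβ hT i0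
  obtain ⟨hb2, hb⟩ := integral_kinDev_sq_le (γ := γ) hω hl hβ hT i1
  have hia : Integrable (fun z : PhaseSpace N => z.2 i0 ^ 2 - T) μ :=
    ((pinnedChain ω₂ lam β γ).integrable_gibbsMeasure
      (pinnedChain_integrable_momentum_pow_mul_gibbsDensity hω hl.le hβ.le γ N hT i0
        (by norm_num : 2 ≤ 4))).sub (integrable_const T)
  have hib : Integrable (fun z : PhaseSpace N => z.2 i1 ^ 2 - T) μ :=
    ((pinnedChain ω₂ lam β γ).integrable_gibbsMeasure
      (pinnedChain_integrable_momentum_pow_mul_gibbsDensity hω hl.le hβ.le γ N hT i1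
        (by norm_num : 2 ≤ 4))).sub (integrable_const T)
  refine ⟨?_, ?_, ?_⟩
  · simp_rw [hg]
    rw [integral_const_mul, integral_sub hia hib,
      pinnedChain_integral_kinObs_gibbsMeasure hω hl.le hβ.le γ N hT i0,
      pinnedChain_integral_kinObs_gibbsMeasure hω hl.le hβ.le γ N hT i1]
    simp
  · have hdom : Integrable (fun z : PhaseSpace N =>
        2 * c ^ 2 * ((z.2 i0 ^ 2 - T) ^ 2 + (z.2 i1 ^ 2 - T) ^ 2)) μ := (ha2.add hb2).const_mul _
    refine hdom.mono' ((continuous_contactImbalance _ T N).pow 2).aestronglyMeasurable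
      (Eventually.of_forall fun z => ?_)
    rw [Real.norm_eq_abs, abs_of_nonneg (sq_nonneg _), hg z]
    nlinarith [sq_nonneg ((z.2 i0 ^ 2 - T) + (z.2 i1 ^ 2 - T)), sq_nonneg c]
  · have hdom : Integrable (fun z : PhaseSpace N =>
        2 * c ^ 2 * ((z.2 i0 ^ 2 - T) ^ 2 + (z.2 i1 ^ 2 - T) ^ 2)) μ := (ha2.add hb2).const_mul _
    have hle : ∀ z, contactImbalance (pinnedChain ω₂ lam β γ) T N z ^ 2 ≤
        2 * c ^ 2 * ((z.2 i0 ^ 2 - T) ^ 2 + (z.2 i1 ^ 2 - T) ^ 2) := fun z => by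
      rw [hg z]
      nlinarith [sq_nonneg ((z.2 i0 ^ 2 - T) + (z.2 i1 ^ 2 - T)), sq_nonneg c]
    calc ∫ z, contactImbalance (pinnedChain ω₂ lam β γ) T N z ^ 2 ∂μ
        ≤ ∫ z, 2 * c ^ 2 * ((z.2 i0 ^ 2 - T) ^ 2 + (z.2 i1 ^ 2 - T) ^ 2) ∂μ :=
          integral_mono_of_nonneg (Eventually.of_forall fun z => sq_nonneg _) hdom
            (Eventually.of_forall hle)
      _ = 2 * c ^ 2 * ((∫ z, (z.2 i0 ^ 2 - T) ^ 2 ∂μ) + ∫ z, (z.2 i1 ^ 2 - T) ^ 2 ∂μ) := by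
          rw [integral_const_mul, integral_add ha2 hb2]
      _ ≤ 2 * c ^ 2 * (2 * T ^ 2 + 2 * T ^ 2) := by gcongr
      _ = 2 * γ ^ 2 / T ^ 2 := by rw [hc]; field_simp; ring

/-- **`C^g_N` is measurable and in `L¹(0,∞)`** (every `N`): `(R) ContactKernelRegular` holds. [folklore] -/
theorem contactKernelRegular_holds : ContactKernelRegular := by
  intro ω₂ lam β γ hω hl hβ hγ T hT N
  rcases Nat.eq_zero_or_pos N with h | hN
  · subst h
    have : contactImbalanceCorr (pinnedChain ω₂ lam β γ) T 0 = fun _ => 0 :=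
      funext (contactImbalanceCorr_zero _ T)
    rw [this]
    exact ⟨measurable_const, integrableOn_zero⟩
  have hθc := continuous_contactImbalance (pinnedChain ω₂ lam β γ) T N
  have hM0 : 0 < γ / T ^ 2 * (2 / (1 / (4 * T)) + T) := by positivity
  have hθM := abs_contactImbalance_le_exp hω hl hβ hγ hT hN
  obtain ⟨h0, -, -⟩ := contactImbalance_statics (γ := γ) hω hl hβ hT hN
  exact ⟨measurable_obsCorr hω hl hβ hγ hT hθc,
    obsCorr_integrableOn hω hl hβ hγ hT hN hθc hM0 hθM h0⟩

/-- **`|C^g_N(u)| ≤ 2γ²/T²`**, uniformly in `N` and `u`. [folklore] -/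
theorem abs_contactImbalanceCorr_le (hω : 0 < ω₂) (hl : 0 < lam) (hβ : 0 < β) (hγ : 0 < γ)
    (hT : 0 < T) (N : ℕ) (u : ℝ) :
    |contactImbalanceCorr (pinnedChain ω₂ lam β γ) T N u| ≤ 2 * γ ^ 2 / T ^ 2 := by
  rcases Nat.eq_zero_or_pos N with h | hN
  · subst h; rw [contactImbalanceCorr_zero, abs_zero]; positivity
  obtain ⟨-, -, hsq⟩ := contactImbalance_statics (γ := γ) hω hl hβ hT hN
  exact obsCorr_abs_le hω hl hβ hγ hT hN (continuous_contactImbalance _ T N)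
    (abs_contactImbalance_le_exp hω hl hβ hγ hT hN) hsq u.toNNReal

/-- **Fejér positivity of the contact kernel at every frequency**: `0 ≤ ∫₀ᵗ (t − r) cos(ωr) C^g_N(r) dr`
(`t ≥ 0`; stationarity of the constructed flow under `μ_T`, `pinnedChain_lagIntegral_cos_mul_nonneg`).
[folklore] -/
theorem contactImbalanceCorr_lagIntegral_nonneg (hω : 0 < ω₂) (hl : 0 < lam) (hβ : 0 < β)
    (hγ : 0 < γ) (hT : 0 < T) (N : ℕ) (ω : ℝ) {t : ℝ} (ht : 0 ≤ t) :
    0 ≤ ∫ r in (0 : ℝ)..t, (t - r) *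
      (Real.cos (ω * r) * contactImbalanceCorr (pinnedChain ω₂ lam β γ) T N r) := by
  rcases Nat.eq_zero_or_pos N with h | hN
  · subst h; simp [contactImbalanceCorr_zero]
  have hinv : ∀ s : ℝ≥0, ((pinnedChain ω₂ lam β γ).gibbsMeasure N T).bind
      ((pinnedChain ω₂ lam β γ).transitionKernel N T T s) =
        (pinnedChain ω₂ lam β γ).gibbsMeasure N T := fun s =>
    pinnedChain_gibbsMeasure_bind_transitionKernel hω hl.le hβ.le hγ.le hN hT s
  haveI : IsProbabilityMeasure ((pinnedChain ω₂ lam β γ).gibbsMeasure N T) :=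
    pinnedChain_isProbabilityMeasure_gibbsMeasure hω hl.le hβ.le γ N hT
  have hθc := continuous_contactImbalance (pinnedChain ω₂ lam β γ) T N
  obtain ⟨-, hg2, -⟩ := contactImbalance_statics (γ := γ) hω hl hβ hT hN
  exact pinnedChain_lagIntegral_cos_mul_nonneg hω hl.le hβ.le hγ.le N T T
    ((pinnedChain ω₂ lam β γ).gibbsMeasure N T) hinv hθc.measurable hg2
    (measurable_obsCorr hω hl hβ hγ hT hθc) ω ht

/-- **`(HB) HighBandSurplusFloor` holds** (every `N ≥ 1`, `B = 32 c₁ γ²/T²`): the contact kernel is a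
bounded (`2γ²/T²`, uniformly in `N`), integrable, positive-definite stationary autocorrelation, so
`highBand_spectral_ge` applies. [folklore] -/
theorem highBandSurplusFloor_holds : HighBandSurplusFloor := by
  intro ω₂ lam β γ hω hl hβ hγ T hT
  refine ⟨16 * (∫ ω in Ioi (0 : ℝ), (1 - Real.cos ω) / ω ^ 2) * (2 * γ ^ 2 / T ^ 2), 1,
    fun N hN t ht => ?_⟩
  obtain ⟨hKm, hKi⟩ := contactKernelRegular_holds ω₂ lam β γ hω hl hβ hγ T hT N
  exact highBand_spectral_ge hKm hKi (abs_contactImbalanceCorr_le hω hl hβ hγ hT N)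
    (fun ω s hs => contactImbalanceCorr_lagIntegral_nonneg hω hl hβ hγ hT N ω hs)
    (zero_le_one.trans ht)

end ContactKernel

/-! ### The door with `(R)` and `(HB)` discharged -/

/-- **The graded door, infrared form**:
`BoundedResponse ⟸ K_T ∧ W ∧ (S) ∧ [GK ∧ WF]` — of the spectral bracket only the fixed-`N` Green–Kubo
identity `(GK)` and the `N`-uniform INFRARED floor `(WF) ContactWarburgFloor` remain; kernel regularity
`(R)` and the high band `(HB)` are theorems (`contactKernelRegular_holds`,
`highBandSurplusFloor_holds`). [folklore] -/
theorem boundedResponse_of_contactWarburgFloor (hK : TransientContactBudgetFixedN)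
    (hW : ExtensiveBlockEnergyVariance) (hG : ContactGreenKubo) (hF : ContactWarburgFloor)
    (hS : SubdiffusiveBondHeat) : BoundedResponse :=
  boundedResponse_of_contactSpectrum hK hW contactKernelRegular_holds hG highBandSurplusFloor_holds
    hF hS

/-- **Equilibrium surplus floor from the infrared floor alone**:
`EquilibriumSurplusFloor ⟸ ContactWarburgFloor` (no bracket). [folklore] -/
theorem equilibriumSurplusFloor_of_contactWarburgFloor (hF : ContactWarburgFloor) :
    EquilibriumSurplusFloor :=
  equilibriumSurplusFloor_of_spectralFloors contactKernelRegular_holds highBandSurplusFloor_holds hF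

/-- **The graded door, surplus form**: `BoundedResponse ⟸ K_T ∧ W ∧ (S) ∧ [GK ∧ ESF]`. [folklore] -/
theorem boundedResponse_of_equilibriumSurplusFloor' (hK : TransientContactBudgetFixedN)
    (hW : ExtensiveBlockEnergyVariance) (hG : ContactGreenKubo) (hE : EquilibriumSurplusFloor)
    (hS : SubdiffusiveBondHeat) : BoundedResponse :=
  boundedResponse_of_equilibriumSurplusFloor hK hW contactKernelRegular_holds hG hE hS

/-- **Exactness certificate**: under the fixed-`N` bracket `K_T ∧ (Q) ∧ GK` and the `N`-uniform
inputs `W ∧ (S)` of the junction, `BoundedResponse ⟺ EquilibriumSurplusFloor`. [folklore] -/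
theorem boundedResponse_iff_equilibriumSurplusFloor' (hK : TransientContactBudgetFixedN)
    (hW : ExtensiveBlockEnergyVariance) (hG : ContactGreenKubo) (hQ : TransientContactHeatNonneg)
    (hS : SubdiffusiveBondHeat) : BoundedResponse ↔ EquilibriumSurplusFloor :=
  boundedResponse_iff_equilibriumSurplusFloor hK hW contactKernelRegular_holds hG hQ hS

end Summit.AtomisticToContinuum.FouriersLaw.Theorems.BoundedResponse.TransientContact

end
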